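import Summits.QuantumFields.BalabanUV.Beta.GAN24.WilsonSectorRow
import Summits.QuantumFields.BalabanUV.Beta.GAN24.CombWilsonSector

/-!
# hS0 for the (III′) cubic-Wilson lineage `combWilsonAt` FROM a (III′) contact-term END with the CONJUGATED dressed leg chains

NOT IN PRINT — OUR BOOKKEEPING (road-P2 = `b2b-balaban-gan24-p2` gen 56, 2026-08-25; row G-an2-4 ∕ (CONV-C), the (α-0) chain at row D1's literal
OF RECORD (III′) `JsB12CombShSym`; [folklore] composition BY NAME; 0 `def`, 0 cite, 0 `def … : Prop`, 0 `sorry`).  Weight 0.  NEVER «G-an2-4 closed» as (CONV-C);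
NOT D1, NOT BetaPertH, NOT continuum, NOT Clay; NO campaign opened (an2 W-4).

This is the (III′) twin of the OWNER gan24-p1 g19's (E) `GAN24/WilsonSectorRow` §2 (`exists_hS0_wilsonSec_of_contact`) for M.50's lineage `CombWilsonSector.combWilsonAt`
(the cubic-Wilson lineage of `CombChartStepJets.ScombOf`; `ScombOf = combWilsonAt + combBornOf`).  Write `R_j = respStepBmSeq ρ_c Lc j` (`ρ_c = ctr (3+1) Lc`),
`ψ♭ α x κ u = Ψ̂ u x (inl κ) (inl α)`, `Ψ̂ = psiKS (ctrOff (3+1) Lc) Lc` (M.47), `T′_k = legChain (fun j ↦ legComp ψ♭ R_j) 0 k`, `B_k = respStep 1 (Lc^(k+1))`.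
* **`exists_hS0_combWilson_of_contact`** (`d = 3`, every `Lc ≥ 1` — the (E) file's idle `2 ≤ Lc` dropped —, the literal's pin `cE = Lc^4`): IF the (III′) contact term of the CONJUGATED dressed Wilson push is main order
  with exponential spread — `hCT′ : ∃ κ′ K, 0 < κ′ ∧ 0 ≤ K ∧ ∀ k κ₁ u′ x′ z′ α β, |push₃ T′_k T′_k T′_k (wilsonA 3) κ₁ u′ x′ z′ (inl α) (inl β) − push₃ B_k B_k B_k (wilsonA 3) …|
  ≤ K·(Lc^{12(k+1)})⁻¹·e^{−κ′(‖x′−u′‖∞ + ‖z′−u′‖∞)}` (the (E) END's shape VERBATIM — leaf-01 g58's `ContactAssembly.exists_contact_bound` — with `T′` in place of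
  `T = legChain R 0 k`; no root quantifier: the comb chart's root is the centred one) — THEN the unit tables of the (III′) Wilson lineage are LOCAL STENCIL FAMILIES WITH
  ONE CONSTANT AND ONE RATE FOR ALL LEVELS: `∃ Cs δS, 0 < δS ∧ ∀ j, LocStencil (unitS (sfStep Lc j) (smStep 3 Lc j) (combWilsonAt Lc cE j)) Cs δS`.
  Route = the (E) one token for token: member `0` by lit `locStencil_wilsonA` + units; member `k+1` = `w_k • push₃ T′ T′ T′ W` (M.50 `unitS_combWilsonAt_succ_eq_push₃`)
  `= w_k • push₃ B B B W + w_k • (contact′)`; the first by the OWNER's part A `WilsonSectorUndressedRow.exists_locStencil_wilsonUndressed_pin` (road S3's row W — UNCHANGED: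
  the undressed push does not see the chart), the second by `hCT′` with `|w_k|·K·(Lc^{12(k+1)})⁻¹ = Lc^4·K` (`WilsonSectorRow.locStencil_of_ff_bound ∕ isFF_sub` BY NAME).
* `exists_hS0_combWilson_of_contact_sub` — the same from a bound on the DIFFERENCE OF THE TWO CONTACT TERMS `(push₃ T′T′T′ − push₃ BBB) − (push₃ TTT − push₃ BBB)
  = push₃ T′T′T′ W − push₃ TTT W` at the centred root plus the (E) END itself (leaf-01's `ContactAssembly.exists_contact_bound` at `rr = ctrOff`): the (III′) Wilson S-row
  costs EXACTLY the `ψ♭`-INSERTION defect of the dressed Wilson push (memo `gen55/S-CAMPAIGN-SIZING-g55.v0_3.md` §3(a): the composite-leg cells, «engine first»).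
WHAT THIS IS NOT: not hS0 for the full (III′) `S` (`combBornOf` remains — M.51 `CombBornSector` is its closed form), not hSdev, not a discharge of `hCT′`; 0 wall binders.
-/

noncomputable section

open Finset
open scoped BigOperators
open Literature.MathematicalPhysics.QuantumFieldTheory
open Literature.MathematicalPhysics.QuantumFieldTheory.Balaban1983to89
open Literature.MathematicalPhysics.QuantumFieldTheory.Balaban1983to89.Beta
open B4ContourShift (supNorm supNorm_nonneg)
open ExpKernelCalculus (MKer)
open OneStepResolventKernel (Fib LocStencil)
open Summit.QuantumFields.BalabanUV.Beta.GAN24.Push4 (IsFF legComp)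
open StepJetData (wilsonA locStencil_wilsonA locStencil_add locStencil_smul)
open AffineAveraging (Site box toSite)
open AveragingContoursRooted (ctr ctrOff ctrOff_mem_box)
open BalabanCompositeJets (respStep)
open Summit.QuantumFields.BalabanUV.Beta.HessKerDressedUnits (unitS locStencil_unitS)
open Summit.QuantumFields.BalabanUV.Beta.GAN24.CombesThomas (sfStep smStep)
open Summit.QuantumFields.BalabanUV.Beta.GAN24.Push4Iter (legChain)
open Summit.QuantumFields.BalabanUV.Beta.GAN24.RespStepBmDecompExact (respStepBmSeq)
open Summit.QuantumFields.BalabanUV.Beta.GAN24.Push3 (push₃ isFF_push₃)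
open Summit.QuantumFields.BalabanUV.Beta.GAN24.StencilSlotOfShapes (locStencil_mono')
open Summit.QuantumFields.BalabanUV.Beta.GAN24.WilsonSectorUndressedRow (exists_locStencil_wilsonUndressed_pin)
open Summit.QuantumFields.BalabanUV.Beta.GAN24.WilsonSectorRow (isFF_sub locStencil_of_ff_bound)
open Summit.QuantumFields.BalabanUV.Beta.SymCorrectorKernel (psiKS)
open Summit.QuantumFields.BalabanUV.Beta.GAN24.CombWilsonSector (combWilsonAt combWilsonAt_zero unitS_combWilsonAt_succ_eq_push₃)

namespace Summit.QuantumFields.BalabanUV.Beta.GAN24.CombWilsonSectorRow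

variable {Lc : ℕ} [NeZero Lc]

/-- NOT IN PRINT; OUR BOOKKEEPING ([folklore]; the (III′) twin of the OWNER's (E) `WilsonSectorRow.exists_hS0_wilsonSec_of_contact`).
**hS0 FOR THE (III′) CUBIC-WILSON LINEAGE, FROM THE (III′) CONTACT-TERM END** (`d = 3`, any `Lc ≥ 1`, the literal's pin `cE = Lc^4`): IF the contact term of the Wilson push
through the CONJUGATED dressed leg chains `T′_k = legChain (fun j ↦ legComp ψ♭ R_j) 0 k` against the undressed composite `B_k = respStep 1 (Lc^(k+1))` is main order with
exponential spread (`hCT′`, the (E) END's shape verbatim with `T′` for `T`), THEN the unit tables of M.50's `combWilsonAt Lc cE` are LOCAL STENCIL FAMILIES WITH ONE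
CONSTANT AND ONE RATE FOR ALL LEVELS `j`.  Route: member `0` by lit `locStencil_wilsonA` + units; member `k+1` = `w_k • push₃ T′ T′ T′ W` (M.50) `= w_k • push₃ B B B W
+ w_k • (contact′)`; the first by the OWNER's part A (road S3's row W, `Lc^4 •`), the second by `hCT′` with `|w_k|·K·(Lc^{12(k+1)})⁻¹ = Lc^4·K`. -/
theorem exists_hS0_combWilson_of_contact {cE : ℝ} (hcE : cE = (Lc : ℝ) ^ (3 + 1))
    (hCT : ∃ κ' K : ℝ, 0 < κ' ∧ 0 ≤ K ∧
      ∀ (k : ℕ) (κ₁ : Fin (3 + 1)) (u' x' z' : Site (3 + 1)) (α β : Fin (3 + 1)),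
        |push₃
            (legChain (fun j => legComp (fun α x κ u => psiKS (ctrOff (3 + 1) Lc) Lc u x (Sum.inl κ) (Sum.inl α)) (respStepBmSeq (d := 3) (ctr (3 + 1) Lc) Lc j)) 0 k)
            (legChain (fun j => legComp (fun α x κ u => psiKS (ctrOff (3 + 1) Lc) Lc u x (Sum.inl κ) (Sum.inl α)) (respStepBmSeq (d := 3) (ctr (3 + 1) Lc) Lc j)) 0 k)
            (legChain (fun j => legComp (fun α x κ u => psiKS (ctrOff (3 + 1) Lc) Lc u x (Sum.inl κ) (Sum.inl α)) (respStepBmSeq (d := 3) (ctr (3 + 1) Lc) Lc j)) 0 k)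
            (wilsonA 3) κ₁ u' x' z' (Sum.inl α) (Sum.inl β)
          - push₃ (respStep (d := 3) 1 (Lc ^ (k + 1))) (respStep (d := 3) 1 (Lc ^ (k + 1))) (respStep (d := 3) 1 (Lc ^ (k + 1)))
            (wilsonA 3) κ₁ u' x' z' (Sum.inl α) (Sum.inl β)|
          ≤ K * ((Lc : ℝ) ^ (12 * (k + 1)))⁻¹ * Real.exp (-(κ' * (supNorm (x' - u') + supNorm (z' - u'))))) :
    ∃ Cs δS : ℝ, 0 < δS ∧ ∀ j : ℕ, LocStencil (unitS (sfStep Lc j) (smStep 3 Lc j) (combWilsonAt (d := 3) Lc cE j)) Cs δS := by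
  have hL : (0 : ℝ) < (Lc : ℝ) := by exact_mod_cast Nat.pos_of_ne_zero (NeZero.ne Lc)
  obtain ⟨κ', K, hκ', hK, hC⟩ := hCT
  obtain ⟨CA, δA, hδA, hA⟩ := exists_locStencil_wilsonUndressed_pin (Lc := Lc) hcE
  -- member `0`: `unitS 1 1 (cE • wilsonA)`, local at rate `1`
  have h0 : LocStencil (unitS (sfStep Lc 0) (smStep 3 Lc 0) (fun κ' u' => cE • wilsonA 3 κ' u')) _ 1 :=
    locStencil_unitS (locStencil_smul cE (locStencil_wilsonA (d := 3) zero_le_one))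
  set C0 : ℝ := |(sfStep Lc 0 * smStep 3 Lc 0)⁻¹| * (max |(sfStep Lc 0)⁻¹| |(smStep 3 Lc 0)⁻¹| * (|cE| * _) *
    max |(sfStep Lc 0)⁻¹| |(smStep 3 Lc 0)⁻¹|) with hC0
  have hCA : 0 ≤ CA := ((hA 0) 0 0).nonneg (Sum.inl 0)
  -- constants: one rate below `δA`, `κ′∕4`, `1`; one constant above all three
  set δS : ℝ := min (min δA (κ' / ((3 : ℝ) + 1))) 1 with hδS
  have hδS0 : 0 < δS := lt_min (lt_min hδA (by positivity)) one_pos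
  have hδS_A : δS ≤ δA := (min_le_left _ _).trans (min_le_left _ _)
  have hδS_κ : δS ≤ κ' / ((3 : ℝ) + 1) := (min_le_left _ _).trans (min_le_right _ _)
  have hδS_1 : δS ≤ 1 := min_le_right _ _
  refine ⟨max (CA + (Lc : ℝ) ^ (3 + 1) * K) C0, δS, hδS0, fun j => ?_⟩
  cases j with
  | zero =>
    rw [combWilsonAt_zero]
    exact locStencil_mono' h0 (le_max_right _ _) hδS_1
  | succ k =>
    rw [unitS_combWilsonAt_succ_eq_push₃ Lc cE k]
    set w : ℝ := cE * (cE * (Lc : ℝ) ^ (2 * (3 + 1))) ^ (k + 1) with hw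
    set PT := push₃
      (legChain (fun j => legComp (fun α x κ u => psiKS (ctrOff (3 + 1) Lc) Lc u x (Sum.inl κ) (Sum.inl α)) (respStepBmSeq (d := 3) (ctr (3 + 1) Lc) Lc j)) 0 k)
      (legChain (fun j => legComp (fun α x κ u => psiKS (ctrOff (3 + 1) Lc) Lc u x (Sum.inl κ) (Sum.inl α)) (respStepBmSeq (d := 3) (ctr (3 + 1) Lc) Lc j)) 0 k)
      (legChain (fun j => legComp (fun α x κ u => psiKS (ctrOff (3 + 1) Lc) Lc u x (Sum.inl κ) (Sum.inl α)) (respStepBmSeq (d := 3) (ctr (3 + 1) Lc) Lc j)) 0 k)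
      (wilsonA 3) with hPT
    set PB := push₃ (respStep (d := 3) 1 (Lc ^ (k + 1))) (respStep (d := 3) 1 (Lc ^ (k + 1))) (respStep (d := 3) 1 (Lc ^ (k + 1)))
      (wilsonA 3) with hPB
    -- split: `w • P_T′ = w • P_B + w • (P_T′ − P_B)`
    have eF : (fun κ' u' => w • PT κ' u') = fun κ' u' => w • PB κ' u' + w • (PT κ' u' - PB κ' u') := by
      funext κ' u'; rw [smul_sub, add_sub_cancel]
    rw [eF]
    -- the undressed part: the OWNER's part A (unchanged at (III′))
    have h1 : LocStencil (fun κ' u' => w • PB κ' u') CA δA := hA k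
    -- the contact part: `hCT′`, packaged, weighted
    have hffD : ∀ κ u, IsFF (PT κ u - PB κ u) := fun κ u => isFF_sub (isFF_push₃ _ _ _ _ κ u) (isFF_push₃ _ _ _ _ κ u)
    have h2 : LocStencil (fun κ u => PT κ u - PB κ u) (K * ((Lc : ℝ) ^ (12 * (k + 1)))⁻¹) (κ' / ((3 : ℝ) + 1)) := by
      refine locStencil_of_ff_bound hffD (by positivity) hκ'.le fun κ u x z α β => ?_
      rw [Pi.sub_apply, Pi.sub_apply, Pi.sub_apply, Pi.sub_apply]
      exact hC k κ u x z α β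
    have h2w := locStencil_smul w h2
    have hwK : |w| * (K * ((Lc : ℝ) ^ (12 * (k + 1)))⁻¹) = (Lc : ℝ) ^ (3 + 1) * K := by
      have hw0 : 0 ≤ w := by rw [hw]; subst hcE; positivity
      rw [abs_of_nonneg hw0, hw, hcE]
      have e : ((Lc : ℝ) ^ (3 + 1) * (Lc : ℝ) ^ (2 * (3 + 1))) ^ (k + 1) = (Lc : ℝ) ^ (12 * (k + 1)) := by
        rw [← pow_add, ← pow_mul]
      rw [e]
      field_simp
    rw [hwK] at h2w
    -- assemble at the common rate
    have h12 := locStencil_add (locStencil_mono' h1 le_rfl hδS_A) (locStencil_mono' h2w le_rfl hδS_κ)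
    exact locStencil_mono' h12 (le_max_left _ _) le_rfl

/-- NOT IN PRINT; OUR BOOKKEEPING ([folklore]).  **THE (III′) WILSON S-ROW COSTS EXACTLY THE `ψ♭`-INSERTION DEFECT OF THE DRESSED WILSON PUSH**: IF, at the centred root,
the (E) contact END holds (`hCT`: leaf-01 g58's `ContactAssembly.exists_contact_bound` shape at `rr = ctrOff (3+1) Lc`, `T_k = legChain R 0 k`) AND the insertion defect
`push₃ T′_k T′_k T′_k W − push₃ T_k T_k T_k W` obeys a bound of the same shape (`hΨ`), THEN hS0 holds for `combWilsonAt` (triangle inequality, then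
`exists_hS0_combWilson_of_contact` with `K + K′` at the smaller rate). -/
theorem exists_hS0_combWilson_of_contact_sub {cE : ℝ} (hcE : cE = (Lc : ℝ) ^ (3 + 1))
    (hCT : ∃ κ' K : ℝ, 0 < κ' ∧ 0 ≤ K ∧
      ∀ (k : ℕ) (κ₁ : Fin (3 + 1)) (u' x' z' : Site (3 + 1)) (α β : Fin (3 + 1)),
        |push₃ (legChain (respStepBmSeq (d := 3) (ctr (3 + 1) Lc) Lc) 0 k) (legChain (respStepBmSeq (d := 3) (ctr (3 + 1) Lc) Lc) 0 k)
            (legChain (respStepBmSeq (d := 3) (ctr (3 + 1) Lc) Lc) 0 k) (wilsonA 3) κ₁ u' x' z' (Sum.inl α) (Sum.inl β)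
          - push₃ (respStep (d := 3) 1 (Lc ^ (k + 1))) (respStep (d := 3) 1 (Lc ^ (k + 1))) (respStep (d := 3) 1 (Lc ^ (k + 1)))
            (wilsonA 3) κ₁ u' x' z' (Sum.inl α) (Sum.inl β)|
          ≤ K * ((Lc : ℝ) ^ (12 * (k + 1)))⁻¹ * Real.exp (-(κ' * (supNorm (x' - u') + supNorm (z' - u')))))
    (hΨ : ∃ κ' K : ℝ, 0 < κ' ∧ 0 ≤ K ∧
      ∀ (k : ℕ) (κ₁ : Fin (3 + 1)) (u' x' z' : Site (3 + 1)) (α β : Fin (3 + 1)),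
        |push₃
            (legChain (fun j => legComp (fun α x κ u => psiKS (ctrOff (3 + 1) Lc) Lc u x (Sum.inl κ) (Sum.inl α)) (respStepBmSeq (d := 3) (ctr (3 + 1) Lc) Lc j)) 0 k)
            (legChain (fun j => legComp (fun α x κ u => psiKS (ctrOff (3 + 1) Lc) Lc u x (Sum.inl κ) (Sum.inl α)) (respStepBmSeq (d := 3) (ctr (3 + 1) Lc) Lc j)) 0 k)
            (legChain (fun j => legComp (fun α x κ u => psiKS (ctrOff (3 + 1) Lc) Lc u x (Sum.inl κ) (Sum.inl α)) (respStepBmSeq (d := 3) (ctr (3 + 1) Lc) Lc j)) 0 k)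
            (wilsonA 3) κ₁ u' x' z' (Sum.inl α) (Sum.inl β)
          - push₃ (legChain (respStepBmSeq (d := 3) (ctr (3 + 1) Lc) Lc) 0 k) (legChain (respStepBmSeq (d := 3) (ctr (3 + 1) Lc) Lc) 0 k)
            (legChain (respStepBmSeq (d := 3) (ctr (3 + 1) Lc) Lc) 0 k) (wilsonA 3) κ₁ u' x' z' (Sum.inl α) (Sum.inl β)|
          ≤ K * ((Lc : ℝ) ^ (12 * (k + 1)))⁻¹ * Real.exp (-(κ' * (supNorm (x' - u') + supNorm (z' - u'))))) :
    ∃ Cs δS : ℝ, 0 < δS ∧ ∀ j : ℕ, LocStencil (unitS (sfStep Lc j) (smStep 3 Lc j) (combWilsonAt (d := 3) Lc cE j)) Cs δS := by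
  obtain ⟨κ₁, K₁, hκ₁, hK₁, h₁⟩ := hCT
  obtain ⟨κ₂, K₂, hκ₂, hK₂, h₂⟩ := hΨ
  refine exists_hS0_combWilson_of_contact hcE ⟨min κ₁ κ₂, K₁ + K₂, lt_min hκ₁ hκ₂, add_nonneg hK₁ hK₂, fun k κ u' x' z' α β => ?_⟩
  have hs : 0 ≤ supNorm (x' - u') + supNorm (z' - u') := add_nonneg (supNorm_nonneg _) (supNorm_nonneg _)
  have hE₁ : Real.exp (-(κ₁ * (supNorm (x' - u') + supNorm (z' - u')))) ≤ Real.exp (-(min κ₁ κ₂ * (supNorm (x' - u') + supNorm (z' - u')))) :=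
    Real.exp_le_exp.2 (by nlinarith [min_le_left κ₁ κ₂])
  have hE₂ : Real.exp (-(κ₂ * (supNorm (x' - u') + supNorm (z' - u')))) ≤ Real.exp (-(min κ₁ κ₂ * (supNorm (x' - u') + supNorm (z' - u')))) :=
    Real.exp_le_exp.2 (by nlinarith [min_le_right κ₁ κ₂])
  have hLk : 0 ≤ ((Lc : ℝ) ^ (12 * (k + 1)))⁻¹ := by positivity
  have a₁ := h₁ k κ u' x' z' α β
  have a₂ := h₂ k κ u' x' z' α β
  -- triangle: (T′ − B) = (T′ − T) + (T − B)
  calc _ ≤ |_| + |_| := by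
          refine (le_of_eq ?_).trans (abs_add_le _ _)
          congr 1; ring
    _ ≤ K₂ * ((Lc : ℝ) ^ (12 * (k + 1)))⁻¹ * Real.exp (-(κ₂ * (supNorm (x' - u') + supNorm (z' - u'))))
        + K₁ * ((Lc : ℝ) ^ (12 * (k + 1)))⁻¹ * Real.exp (-(κ₁ * (supNorm (x' - u') + supNorm (z' - u')))) := add_le_add a₂ a₁
    _ ≤ K₂ * ((Lc : ℝ) ^ (12 * (k + 1)))⁻¹ * Real.exp (-(min κ₁ κ₂ * (supNorm (x' - u') + supNorm (z' - u'))))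
        + K₁ * ((Lc : ℝ) ^ (12 * (k + 1)))⁻¹ * Real.exp (-(min κ₁ κ₂ * (supNorm (x' - u') + supNorm (z' - u')))) :=
          add_le_add (mul_le_mul_of_nonneg_left hE₂ (mul_nonneg hK₂ hLk)) (mul_le_mul_of_nonneg_left hE₁ (mul_nonneg hK₁ hLk))
    _ = (K₁ + K₂) * ((Lc : ℝ) ^ (12 * (k + 1)))⁻¹ * Real.exp (-(min κ₁ κ₂ * (supNorm (x' - u') + supNorm (z' - u')))) := by ring

end Summit.QuantumFields.BalabanUV.Beta.GAN24.CombWilsonSectorRow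

end
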